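import Literature.Computability.Complexity.EquivalenceProblems
import Literature.Computability.Complexity.AdaptiveFunctions
import Literature.Computability.Complexity.CodeFPArith
import Literature.Computability.Complexity.LengthCompare
import Literature.Computability.Complexity.ReductionsProofs
import HarnessLib

/-!
# `PEq ⊆ LexEq(FP^NP)`: the first canonical form of a `P`-decidable equivalence relation is in `FP^NP`
# (Blass–Gurevich 1984; Fortnow–Grochow 2011, §3) — discharge of `blassGurevich_PEq_subset_LexEq_FPNP`

Fortnow–Grochow 2011 (= arXiv:0907.4775), §3, first paragraph (after Blass–Gurevich 1984, §1):
"If `R ∈ PEq`, then the language `R' = {(x, y) : (∃ z)[z ≤_lex y and (x, z) ∈ R]}` is in `NP`, and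
can be used to perform a binary search for the first canonical form for `R`. Hence
`PEq ⊆ LexEq(FP^NP)`." This second proof file of `EquivalenceProblems.lean` (next to
`EquivalenceProblemsProofs.lean`, which discharges the unrelativized `P = NP` instance
`blassGurevich_LexEq_of_P_eq_NP` by search-to-decision; the two proof files are independent and
neither imports the other) proves the tree's rendering
`Literature.Computability.Complexity.blassGurevich_PEq_subset_LexEq_FPNP`
(`∀ E ∈ PEq, ∃ A ∈ NP, ∃ c ∈ FP^A, IsFirstCanonicalFormFor E c`).

## The proof and its rendering

The printed binary search over the length-lexicographic order is run in its equivalent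
*prefix form* (one `NP` query per output bit — the bit-by-bit self-reduction of Arora–Barak 2009,
§2.5, Thm. 2.18 and §17.2.1; cf. the tree's `SearchToDecision.lean`, which grows suffixes), which
avoids converting between shortlex ranks and numerals: on input `x` of length `n` the oracle
transducer

1. asks, for `j = 0, …, n`, whether `[x]_E` has a member of length `≤ j` — the answers are
   `[m ≤ j]` for the minimal length `m ≤ n` of the class, so `m` is the number of negative answers;
2. asks, for `n` further rounds, whether `[x]_E` has a member of length `≤ m` (hence `= m`)
   extending the prefix found so far by a `0` — after `k ≤ m` rounds the negated answers are the
   first `k` bits of the lexicographically first member of length `m`, i.e. of the shortlex-first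
   member `firstOf` of the class;
3. outputs the first `m` negated phase-2 answers.

All queries go to the single `NP` language
`prefLang E = {⟨x, ⟨u, p⟩⟩ | ∃ z, |z| ≤ |u| ∧ p ⊑ z ∧ x ~ z}` (`prefLang_mem_NP`: the verifier
language `prefRel E` is a length test, a prefix test and the recognition problem of `E`, all in `P`).
The machine is the tree's adaptive oracle transducer `AdQuery.adFn Q q G` (`AdaptiveFunctions.lean`,
`adFn_mem_FPRel`: query generator `Q ∈ FP` reading the input and the answer bits so far, budget
`q = 2X + 1`, output map `G ∈ FP`); `Q` and `G` are the string maps `qry`, `out`, placed in `FP` by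
the typed combinators of `CodeFP.lean` / `CodeFPArith.lean` and two one-state transducers
(`notT`: bitwise negation; `cntT`: the unary count of `0`s).

## Main statements

* `firstOf hE x`, `isFirstCanonicalFormFor_firstOf` — the shortlex-first member of `[x]_E`
  (`WellFounded.min` for Mathlib's `List.Shortlex.wf`);
* `prefLang_mem_NP`, `pair_mem_prefLang`;
* `codeFP_qry`, `codeFP_out`, `out_adBits` (correctness of the search);
* `blassGurevich_PEq_subset_LexEq_FPNP_holds`.

## References

* A. Blass, Y. Gurevich, *Equivalence relations, invariants, and normal forms*, SIAM J. Comput.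
  13 (1984) 682–689, §1 [BlassGurevich1984].
* L. Fortnow, J. A. Grochow, *Complexity classes of equivalence problems revisited*, Inform.
  Comput. 209 (2011) 748–763 = arXiv:0907.4775, §3 (first paragraph) [FortnowGrochow2011].
* S. Arora, B. Barak, *Computational Complexity: A Modern Approach*, CUP 2009, §2.5 (decision
  versus search), §3.4 (oracle machines), §17.2.1 (binary search with an oracle) [AroraBarak2009].
-/

namespace Literature.Computability.Complexity

open _root_.Computability Polynomial

namespace LexFirstSearch

/-! ### The shortlex-first member of an equivalence class -/

/-- The length-lexicographic order on `{0,1}*` (`false < true`) is well-founded.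
[Fortnow–Grochow 2011, §2.2 (standard ordering)] [folklore] -/
theorem shortlex_wf : WellFounded (List.Shortlex (· < ·) : List Bool → List Bool → Prop) :=
  List.Shortlex.wf wellFounded_lt

section First

variable {E : List Bool → List Bool → Prop} (hE : Equivalence E)

/-- `firstOf hE x`: the shortlex-first member of the class `[x]_E` (the value of the first
canonical form). [Fortnow–Grochow 2011, §1 (first canonical form problem)]
[cite: FortnowGrochow2011, §1 (first canonical form)] -/
noncomputable def firstOf (x : List Bool) : List Bool :=
  shortlex_wf.min {z | E z x} ⟨x, hE.refl x⟩

/-- `firstOf hE x ~ x`. [folklore] -/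
theorem firstOf_rel (x : List Bool) : E (firstOf hE x) x :=
  shortlex_wf.min_mem {z | E z x} ⟨x, hE.refl x⟩

/-- No member of `[x]_E` precedes `firstOf hE x`. [folklore] -/
theorem not_shortlex_firstOf {x y : List Bool} (h : E y x) :
    ¬ List.Shortlex (· < ·) y (firstOf hE x) :=
  shortlex_wf.not_lt_min {z | E z x} h

/-- `firstOf hE` is the first canonical form of `E`. [Fortnow–Grochow 2011, §1]
[cite: FortnowGrochow2011, §1 (first canonical form)] -/
theorem isFirstCanonicalFormFor_firstOf : IsFirstCanonicalFormFor E (firstOf hE) :=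
  fun x => ⟨firstOf_rel hE x, fun _ hy => not_shortlex_firstOf hE hy⟩

/-- Every member of `[x]_E` is at least as long as `firstOf hE x`. [folklore] -/
theorem length_firstOf_le_of_rel {x z : List Bool} (h : E x z) : (firstOf hE x).length ≤ z.length := by
  by_contra hlt
  exact not_shortlex_firstOf hE (hE.symm h) (List.Shortlex.of_length_lt (by omega))

/-- `|firstOf hE x| ≤ |x|`. [folklore] -/
theorem length_firstOf_le (x : List Bool) : (firstOf hE x).length ≤ x.length :=
  length_firstOf_le_of_rel hE (hE.refl x)

/-- **The phase-1 answers**: `[x]_E` has a member of length `≤ j` iff `|firstOf hE x| ≤ j`. [folklore] -/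
theorem exists_length_le_iff (x : List Bool) (j : ℕ) :
    (∃ z, z.length ≤ j ∧ [] <+: z ∧ E x z) ↔ (firstOf hE x).length ≤ j := by
  constructor
  · rintro ⟨z, hz, -, hxz⟩
    exact (length_firstOf_le_of_rel hE hxz).trans hz
  · intro h
    exact ⟨firstOf hE x, h, List.nil_prefix, hE.symm (firstOf_rel hE x)⟩

/-- **The phase-2 answers**: for `k < m = |firstOf hE x|`, the class has a member of length `≤ m`
extending `(firstOf hE x) ↾ k` by a `0` iff bit `k` of `firstOf hE x` is `0` (a member of length
`m` lexicographically below `firstOf hE x` would precede it). [folklore] -/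
theorem exists_prefix_iff (x : List Bool) {k : ℕ} (hk : k < (firstOf hE x).length) :
    (∃ z, z.length ≤ (firstOf hE x).length ∧ ((firstOf hE x).take k ++ [false]) <+: z ∧ E x z) ↔
      (firstOf hE x)[k] = false := by
  constructor
  · rintro ⟨z, hzlen, ⟨t, rfl⟩, hxz⟩
    by_contra hne
    have htrue : (firstOf hE x)[k] = true := by simpa using hne
    have hlen : ((firstOf hE x).take k ++ [false] ++ t).length = (firstOf hE x).length :=
      le_antisymm hzlen (length_firstOf_le_of_rel hE hxz)
    refine not_shortlex_firstOf hE (hE.symm hxz) (List.Shortlex.of_lex hlen ?_)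
    have hsplit : (firstOf hE x).take k ++ (true :: (firstOf hE x).drop (k + 1)) = firstOf hE x := by
      rw [← htrue, ← List.drop_eq_getElem_cons hk, List.take_append_drop]
    have key : List.Lex (· < ·) ((firstOf hE x).take k ++ (false :: t))
        ((firstOf hE x).take k ++ (true :: (firstOf hE x).drop (k + 1))) :=
      List.Lex.append_left _ (List.Lex.rel Bool.false_lt_true) _
    rwa [hsplit, ← List.singleton_append, ← List.append_assoc] at key
  · intro h
    refine ⟨firstOf hE x, le_rfl, ?_, hE.symm (firstOf_rel hE x)⟩
    rw [← h, ← List.take_succ_eq_append_getElem hk]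
    exact List.take_prefix _ _

end First

/-! ### The `NP` oracle: members of bounded length with a prescribed prefix -/

/-- `⟨x, y⟩ ∈ relLang E ↔ x ~ y` (the pairing is injective). Private twin of
`ShortlexSearch.boolPair_mem_relLang` (`EquivalenceProblemsProofs.lean`), kept local so that the
two proof files of `EquivalenceProblems.lean` stay import-independent. [folklore] -/
private theorem boolPair_mem_relLang {E : List Bool → List Bool → Prop} (x y : List Bool) :
    boolPair x y ∈ relLang E ↔ E x y := by
  constructor
  · rintro ⟨x', y', h, hxy⟩
    have h' := congrArg boolUnpair h
    simp only [boolUnpair_boolPair, Prod.mk.injEq] at h'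
    rw [h'.1, h'.2]
    exact hxy
  · exact fun h => ⟨x, y, rfl, h⟩

section Oracle

variable (E : List Bool → List Bool → Prop)

/-- **The verifier language** of `prefLang E`: `⟨⟨x, ⟨u, p⟩⟩, z⟩ ∈ prefRel E` iff `|z| ≤ |u|`,
`p` is a prefix of `z` and `x ~ z` (components read by the total decoder `boolUnpair`).
[Fortnow–Grochow 2011, §3 (the `NP` language `R'`), Arora–Barak 2009, Def. 2.1] [folklore] -/
def prefRel : Language Bool :=
  {v | (sndP v).length ≤ (fstP (sndP (fstP v))).length ∧
    (sndP v).take (sndP (sndP (fstP v))).length = sndP (sndP (fstP v)) ∧ E (fstP (fstP v)) (sndP v)}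

/-- **The oracle language** `prefLang E = {⟨x, ⟨u, p⟩⟩ | ∃ z, |z| ≤ |u| ∧ p ⊑ z ∧ x ~ z}`, written
in verifier form with witness bound `X` (the prefix-search form of Fortnow–Grochow's
`R' = {(x, y) : ∃ z ≤_lex y, (x, z) ∈ R}`). [cite: FortnowGrochow2011, §3 (first paragraph)] -/
def prefLang : Language Bool :=
  {w | ∃ z : List Bool, z.length ≤ (X : Polynomial ℕ).eval w.length ∧ boolPair w z ∈ prefRel E}

variable {E}

/-- Membership of a genuine code in `prefRel E`. [folklore] -/
theorem pair_mem_prefRel (x u p z : List Bool) :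
    boolPair (boolPair x (boolPair u p)) z ∈ prefRel E ↔ z.length ≤ u.length ∧ p <+: z ∧ E x z := by
  change (_ ∧ _ ∧ _) ↔ _
  simp only [fstP_boolPair, sndP_boolPair, List.prefix_iff_eq_take]
  constructor <;> rintro ⟨h1, h2, h3⟩ <;> exact ⟨h1, h2.symm, h3⟩

/-- **Membership of a query in `prefLang E`**: `⟨x, ⟨u, p⟩⟩ ∈ prefLang E ↔ ∃ z, |z| ≤ |u| ∧ p ⊑ z ∧ x ~ z`.
[cite: FortnowGrochow2011, §3 (first paragraph)] -/
theorem pair_mem_prefLang (x u p : List Bool) :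
    boolPair x (boolPair u p) ∈ prefLang E ↔ ∃ z, z.length ≤ u.length ∧ p <+: z ∧ E x z := by
  change (∃ z : List Bool, _ ∧ _ ∈ prefRel E) ↔ _
  simp only [pair_mem_prefRel, eval_X, length_boolPair]
  constructor
  · rintro ⟨z, -, hz⟩
    exact ⟨z, hz⟩
  · rintro ⟨z, hz⟩
    exact ⟨z, by omega, hz⟩

/-- **`prefRel E ∈ P`** when the recognition problem of `E` is in `P`: the intersection of a
length test (`LenLe X` pulled back along `v ↦ ⟨u, z⟩`), the prefix test `z ↾ |p| = p` (an equality of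
two `FP` maps) and the recognition problem pulled back along `v ↦ ⟨x, z⟩`.
[Arora–Barak 2009, §1.3, Thm. 2.8] [folklore] -/
theorem prefRel_mem_P (hP : relLang E ∈ Classes.P) : prefRel E ∈ Classes.P := by
  have hxF : (fstP ∘ fstP) ∈ FP := comp_mem_FP fstP_mem_FP fstP_mem_FP
  have huF : (fstP ∘ sndP ∘ fstP) ∈ FP := comp_mem_FP fstP_mem_FP (comp_mem_FP sndP_mem_FP fstP_mem_FP)
  have hpF : (sndP ∘ sndP ∘ fstP) ∈ FP := comp_mem_FP sndP_mem_FP (comp_mem_FP sndP_mem_FP fstP_mem_FP)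
  obtain ⟨tk, htk, htk_spec⟩ :
      CodeFP CodeFP.strE CodeFP.strE (fun v : List Bool => (sndP v).take ((sndP ∘ sndP ∘ fstP) v).length) :=
    CodeFP.strTake.comp ((CodeFP.strLength.comp (CodeFP.of_fn _ hpF (fun _ => rfl))).pair
      (CodeFP.of_fn sndP sndP_mem_FP (fun _ => rfl)))
  have h1 : (pairFn (fstP ∘ sndP ∘ fstP) sndP ⁻¹' LenLe X : Language Bool) ∈ Classes.P :=
    preimage_mem_P (LenLe_mem_P X) (pairFn_mem_FP huF sndP_mem_FP)
  have h2 : ({v | tk v = (sndP ∘ sndP ∘ fstP) v} : Language Bool) ∈ Classes.P :=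
    setOf_apply_eq_apply_mem_P htk hpF
  have h3 : (pairFn (fstP ∘ fstP) sndP ⁻¹' relLang E : Language Bool) ∈ Classes.P :=
    preimage_mem_P hP (pairFn_mem_FP hxF sndP_mem_FP)
  have heq : prefRel E = (pairFn (fstP ∘ sndP ∘ fstP) sndP ⁻¹' LenLe X) ⊓
      (({v | tk v = (sndP ∘ sndP ∘ fstP) v} : Language Bool) ⊓ (pairFn (fstP ∘ fstP) sndP ⁻¹' relLang E)) := by
    ext v
    change (_ ∧ _ ∧ _) ↔ pairFn _ _ v ∈ LenLe X ∧ tk v = _ ∧ pairFn _ _ v ∈ relLang E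
    rw [pairFn_apply, pairFn_apply, boolPair_mem_LenLe, eval_X, boolPair_mem_relLang,
      show tk v = _ from htk_spec v]
    rfl
  rw [heq]
  exact inter_mem_P h1 (inter_mem_P h2 h3)

/-- **`prefLang E ∈ NP`** for `E` with recognition problem in `P` (verifier `prefRel E`, witness
bound `X`). [cite: FortnowGrochow2011, §3 (first paragraph)] -/
theorem prefLang_mem_NP (hP : relLang E ∈ Classes.P) : prefLang E ∈ Nondeterministic.NP :=
  ⟨prefRel E, prefRel_mem_P hP, X, fun _ => Iff.rfl⟩

end Oracle

/-! ### The query generator and the output map -/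

/-- **The query generator** on (input, answer bits so far): in phase 1 (`|bits| ≤ |x|`) the query
`⟨x, ⟨1^{|bits|}, ε⟩⟩` ("a member of length `≤ |bits|`?"); in phase 2 the query
`⟨x, ⟨1ᵐ, p0⟩⟩` with `m` the number of negative phase-1 answers (the first `|x| + 1` bits) and `p`
the bitwise negation of the phase-2 answers so far. [cite: FortnowGrochow2011, §3 (first paragraph)] -/
def qry (a : List Bool × List Bool) : List Bool :=
  if a.2.length ≤ a.1.length then boolPair a.1 (boolPair (CodeFP.unE a.2.length) [])
  else boolPair a.1 (boolPair (CodeFP.unE ((a.2.take (a.1.length + 1)).count false))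
    ((a.2.drop (a.1.length + 1)).map not ++ [false]))

/-- **The output map**: the first `m` negated phase-2 answers. [cite: FortnowGrochow2011, §3 (first paragraph)] -/
def out (a : List Bool × List Bool) : List Bool :=
  ((a.2.drop (a.1.length + 1)).map not).take ((a.2.take (a.1.length + 1)).count false)

/-- The one-state transducer negating every bit. [folklore] -/
def notT : FST Unit Bool Bool where
  init := ()
  step _ b := ((), [!b])
  front _ := []
  keep _ := true

/-- The run of `notT`. [folklore] -/
theorem notT_run (s : List Bool) : notT.run () s = ((), s.map not) := by
  induction s with
  | nil => rfl
  | cons b s ih => rw [FST.run_cons]; simp [notT] at ih ⊢; rw [ih]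

/-- `notT` computes bitwise negation. [folklore] -/
theorem notT_eval (s : List Bool) : notT.eval s = s.map not := by
  rw [FST.eval, show notT.init = () from rfl, notT_run]
  simp [notT]

/-- The one-state transducer emitting a `1` per `0` read: the unary count of `0`s. [folklore] -/
def cntT : FST Unit Bool Bool where
  init := ()
  step _ b := ((), if b then [] else [true])
  front _ := []
  keep _ := true

/-- The run of `cntT`. [folklore] -/
theorem cntT_run (s : List Bool) : cntT.run () s = ((), CodeFP.unE (s.count false)) := by
  induction s with
  | nil => rfl
  | cons b s ih =>
    rw [FST.run_cons, show cntT.step () b = ((), if b then [] else [true]) from rfl]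
    dsimp only
    rw [ih, List.count_cons]
    cases b <;> simp [CodeFP.unE, unaryEncodeNat]

/-- `cntT` computes the unary count of `0`s. [folklore] -/
theorem cntT_eval (s : List Bool) : cntT.eval s = CodeFP.unE (s.count false) := by
  rw [FST.eval, show cntT.init = () from rfl, cntT_run]
  simp [cntT]

/-- Bitwise negation, typed. [folklore] -/
theorem codeFP_not : CodeFP CodeFP.strE CodeFP.strE (fun s : List Bool => s.map not) :=
  CodeFP.of_fn notT.eval notT.polyTimeComputable_eval notT_eval

/-- The unary count of `0`s, typed. [folklore] -/
theorem codeFP_cnt : CodeFP CodeFP.strE CodeFP.unE (fun s : List Bool => s.count false) :=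
  CodeFP.of_fn cntT.eval cntT.polyTimeComputable_eval cntT_eval

/-- The phase test `[|bits| ≤ |x|]` (`lenLeFn X` of `LengthCompare.lean`). [folklore] -/
theorem codeFP_phase :
    CodeFP (CodeFP.pairE CodeFP.strE CodeFP.strE) CodeFP.bitE
      (fun a : List Bool × List Bool => decide (a.2.length ≤ a.1.length)) :=
  CodeFP.of_fn (lenLeFn X) (lenLeFn_mem_FP X) fun a => by
    rw [CodeFP.pairE_apply, lenLeFn_boolPair, eval_X]; rfl

/-- The number `m` of negative phase-1 answers, in unary, typed. [folklore] -/
theorem codeFP_cntPhase1 :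
    CodeFP (CodeFP.pairE CodeFP.strE CodeFP.strE) CodeFP.unE
      (fun a : List Bool × List Bool => (a.2.take (a.1.length + 1)).count false) :=
  have hn1 : CodeFP (CodeFP.pairE CodeFP.strE CodeFP.strE) CodeFP.unE
      (fun a : List Bool × List Bool => a.1.length + 1) :=
    CodeFP.unSucc.comp (CodeFP.strLength.comp (CodeFP.fst _ _))
  codeFP_cnt.comp (CodeFP.strTake.comp (hn1.pair (CodeFP.snd _ _)))

/-- The negated phase-2 answers, typed. [folklore] -/
theorem codeFP_negPhase2 :
    CodeFP (CodeFP.pairE CodeFP.strE CodeFP.strE) CodeFP.strE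
      (fun a : List Bool × List Bool => (a.2.drop (a.1.length + 1)).map not) :=
  have hn1 : CodeFP (CodeFP.pairE CodeFP.strE CodeFP.strE) CodeFP.unE
      (fun a : List Bool × List Bool => a.1.length + 1) :=
    CodeFP.unSucc.comp (CodeFP.strLength.comp (CodeFP.fst _ _))
  codeFP_not.comp (CodeFP.strDrop.comp (hn1.pair (CodeFP.snd _ _)))

/-- **The query generator is polynomial-time** (on codes `⟨x, bits⟩`). [cite: AroraBarak2009, §1.3] -/
theorem codeFP_qry : CodeFP (CodeFP.pairE CodeFP.strE CodeFP.strE) CodeFP.strE qry := by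
  have hx : CodeFP (CodeFP.pairE CodeFP.strE CodeFP.strE) CodeFP.strE
      (fun a : List Bool × List Bool => a.1) := CodeFP.fst _ _
  have hlen : CodeFP (CodeFP.pairE CodeFP.strE CodeFP.strE) CodeFP.unE
      (fun a : List Bool × List Bool => a.2.length) := CodeFP.strLength.comp (CodeFP.snd _ _)
  have hnil : CodeFP (CodeFP.pairE CodeFP.strE CodeFP.strE) CodeFP.strE
      (fun _ : List Bool × List Bool => ([] : List Bool)) := CodeFP.const _ _
  have hfalse : CodeFP (CodeFP.pairE CodeFP.strE CodeFP.strE) CodeFP.strE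
      (fun _ : List Bool × List Bool => ([false] : List Bool)) := CodeFP.const _ _
  have hP : CodeFP (CodeFP.pairE CodeFP.strE CodeFP.strE) CodeFP.strE
      (fun a : List Bool × List Bool => (a.2.drop (a.1.length + 1)).map not ++ [false]) :=
    CodeFP.strAppend.comp (codeFP_negPhase2.pair hfalse)
  have h1 : CodeFP (CodeFP.pairE CodeFP.strE CodeFP.strE) CodeFP.strE
      (fun a : List Bool × List Bool => boolPair a.1 (boolPair (CodeFP.unE a.2.length) [])) :=
    (hx.pair (hlen.pair hnil)).recodeOut fun _ => rfl
  have h2 : CodeFP (CodeFP.pairE CodeFP.strE CodeFP.strE) CodeFP.strE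
      (fun a : List Bool × List Bool => boolPair a.1
        (boolPair (CodeFP.unE ((a.2.take (a.1.length + 1)).count false))
          ((a.2.drop (a.1.length + 1)).map not ++ [false]))) :=
    (hx.pair (codeFP_cntPhase1.pair hP)).recodeOut fun _ => rfl
  exact (codeFP_phase.ite h1 h2).congr fun a => by
    by_cases h : a.2.length ≤ a.1.length <;> simp [qry, h]

/-- **The output map is polynomial-time** (on codes `⟨x, bits⟩`). [cite: AroraBarak2009, §1.3] -/
theorem codeFP_out : CodeFP (CodeFP.pairE CodeFP.strE CodeFP.strE) CodeFP.strE out :=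
  CodeFP.strTake.comp (codeFP_cntPhase1.pair codeFP_negPhase2)

/-! ### Correctness of the search -/

/-- The round budget `2n + 1` (`n + 1` length queries, `n` prefix queries). [folklore] -/
noncomputable def budget : Polynomial ℕ := 2 * X + 1

/-- `budget(n) = (n + 1) + n`. [folklore] -/
theorem budget_eval (n : ℕ) : budget.eval n = n + 1 + n := by
  simp [budget]; omega

/-- The indicator bit of a language at a string whose membership is characterised by a decidable
proposition. [folklore] -/
theorem boolIndicator_eq_decide (A : Language Bool) (w : List Bool) (P : Prop) [Decidable P]
    (h : w ∈ A ↔ P) : (A : Set (List Bool)).boolIndicator w = decide P := by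
  by_cases hP : P
  · rw [decide_eq_true hP]
    exact (Set.mem_iff_boolIndicator _ _).1 (h.2 hP)
  · rw [decide_eq_false hP]
    exact (Set.notMem_iff_boolIndicator _ _).1 (fun hw => hP (h.1 hw))

/-- Counting the negative threshold answers: `#{j < N | ¬ m ≤ j} = min m N`. [folklore] -/
theorem count_false_thresholds (m N : ℕ) :
    ((List.range N).map (fun j => decide (m ≤ j))).count false = min m N := by
  induction N with
  | zero => simp
  | succ N ih =>
    rw [List.range_succ, List.map_append, List.count_append, ih, List.map_singleton]
    by_cases h : m ≤ N
    · simp [h]; omega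
    · simp [h]; omega

section Search

variable {E : List Bool → List Bool → Prop} (hE : Equivalence E)
  {Q : List Bool → List Bool} (hQ : ∀ x b, Q (boolPair x b) = qry (x, b))
  {A : Language Bool} (hA : ∀ x u p, boolPair x (boolPair u p) ∈ A ↔ ∃ z, z.length ≤ u.length ∧ p <+: z ∧ E x z)

include hQ hA

/-- **Phase 1**: the first `i ≤ n + 1` answer bits are the thresholds `[m ≤ j]`, `j < i`
(`m = |firstOf hE x|`). [folklore] -/
theorem adBits_phase1 (x : List Bool) : ∀ i ≤ x.length + 1,
    AdQuery.adBits Q A x i = (List.range i).map (fun j => decide ((firstOf hE x).length ≤ j))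
  | 0, _ => by simp
  | i + 1, hi => by
    have ih := adBits_phase1 x i (Nat.le_of_succ_le hi)
    rw [AdQuery.adBits_succ, ih, List.range_succ, List.map_append, List.map_singleton]
    congr 2
    have hlen : ((List.range i).map (fun j => decide ((firstOf hE x).length ≤ j))).length ≤ x.length := by
      simp; omega
    rw [hQ, qry, if_pos hlen]
    refine boolIndicator_eq_decide A _ _ ?_
    rw [hA, CodeFP.length_unE, List.length_map, List.length_range]
    exact exists_length_le_iff hE x i

/-- The number of negative phase-1 answers is `m = |firstOf hE x|`. [folklore] -/
theorem count_phase1 (x : List Bool) (k : ℕ) :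
    ((AdQuery.adBits Q A x (x.length + 1 + k)).take (x.length + 1)).count false = (firstOf hE x).length := by
  rw [AdQuery.adBits_take A x (Nat.le_add_right _ _), adBits_phase1 hE hQ hA x _ le_rfl,
    count_false_thresholds]
  have := length_firstOf_le hE x
  omega

/-- **Phase 2**: after `k ≤ m` further rounds the negated phase-2 answers are the first `k` bits
of `firstOf hE x`. [folklore] -/
theorem phase2_eq_take (x : List Bool) : ∀ k ≤ (firstOf hE x).length,
    ((AdQuery.adBits Q A x (x.length + 1 + k)).drop (x.length + 1)).map not = (firstOf hE x).take k
  | 0, _ => by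
    rw [Nat.add_zero, List.drop_eq_nil_of_le (by rw [AdQuery.length_adBits]), List.map_nil, List.take_zero]
  | k + 1, hk => by
    have ih := phase2_eq_take x k (Nat.le_of_succ_le hk)
    have hk' : k < (firstOf hE x).length := hk
    rw [show x.length + 1 + (k + 1) = x.length + 1 + k + 1 from rfl, AdQuery.adBits_succ,
      List.drop_append_of_le_length (by rw [AdQuery.length_adBits]; omega), List.map_append, ih,
      List.map_singleton, List.take_succ_eq_append_getElem hk']
    congr 2
    have hlen : ¬ (AdQuery.adBits Q A x (x.length + 1 + k)).length ≤ x.length := by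
      rw [AdQuery.length_adBits]; omega
    rw [hQ, qry, if_neg hlen, count_phase1 hE hQ hA x k, ih,
      boolIndicator_eq_decide A _ ((firstOf hE x)[k] = false)
        (by rw [hA, CodeFP.length_unE]; exact exists_prefix_iff hE x hk')]
    cases (firstOf hE x)[k] <;> rfl

/-- **Correctness of the search**: the output map applied to the full transcript of `2n + 1`
answers is `firstOf hE x`. [cite: FortnowGrochow2011, §3 (first paragraph)] -/
theorem out_adBits (x : List Bool) :
    out (x, AdQuery.adBits Q A x (x.length + 1 + x.length)) = firstOf hE x := by
  have hm := length_firstOf_le hE x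
  rw [out]
  dsimp only
  rw [count_phase1 hE hQ hA x x.length, ← List.map_take, List.take_drop,
    AdQuery.adBits_take A x (by omega), phase2_eq_take hE hQ hA x _ le_rfl, List.take_length]

end Search

end LexFirstSearch

/-! ### The discharge -/

open LexFirstSearch in
/-- **`PEq ⊆ LexEq(FP^NP)`** (Blass–Gurevich 1984, §1; Fortnow–Grochow 2011, §3, first paragraph):
every equivalence relation with recognition problem in `P` has its first canonical form computable
in polynomial time with an `NP` oracle — here the oracle `prefLang E ∈ NP` and the adaptive oracle
transducer `AdQuery.adFn Q (2X + 1) G` running the prefix form of the printed binary search.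
Discharges `blassGurevich_PEq_subset_LexEq_FPNP`. [cite: FortnowGrochow2011, §3 (first paragraph)] -/
theorem blassGurevich_PEq_subset_LexEq_FPNP_holds : blassGurevich_PEq_subset_LexEq_FPNP := by
  rintro E ⟨hE, hP⟩
  obtain ⟨Q, hQ, hQs⟩ := codeFP_qry
  obtain ⟨G, hG, hGs⟩ := codeFP_out
  refine ⟨prefLang E, prefLang_mem_NP hP, AdQuery.adFn Q budget G (prefLang E),
    AdQuery.adFn_mem_FPRel hQ hG _, ?_⟩
  have hc : AdQuery.adFn Q budget G (prefLang E) = firstOf hE := by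
    funext x
    rw [AdQuery.adFn_apply, budget_eval]
    exact (hGs (x, _)).trans
      (out_adBits hE (fun x b => hQs (x, b)) (fun x u p => pair_mem_prefLang x u p) x)
  rw [hc]
  exact isFirstCanonicalFormFor_firstOf hE

end Literature.Computability.Complexity
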